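import Literature.MathematicalPhysics.QuantumFieldTheory.MullerSchiemann1987.MS87MigdalRecursion
import HarnessLib

/-!
# Müller–Schiemann, *Continuum limit of a hierarchical SU(2) lattice gauge theory in 4 dimensions*
# (CMP 110, 1987), FROM THE PROOF OF THEOREM 3 (p.283 L.38–39): «The property 𝒯g^{(−n−1)}(u) = g^{(−n)}(u)
# implies g^{(−n)}(u) > 0 on G, since g^{(−n−1)}(u) is nonnegative and vanishes at most on a set of Haar measure
# zero» — PROVED for Migdal's recursion (1.1) on an arbitrary compact group (theorems only; no definition, no fact)

statement-level skeleton of published theorems with citation tags; proofs where landed; nothing here is a claim about the Yang–Mills mass gap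

**Citation header (reproduction of PUBLISHED work).** V. F. Müller, J. Schiemann, *Continuum limit of a hierarchical
SU(2) lattice gauge theory in 4 dimensions*, Commun. Math. Phys. **110** (1987) 261–286, doi 10.1007/BF01207367
[MullerSchiemann1987]; (1.1) p.262, Theorem 3 p.282, its proof p.283 L.19–21 and L.38–39 (held Project Euclid scan
`paper:url-96df5da18d4c`; displays read by this seat on its own 3× page renders
`run/shared/lean/pub/lit-balaban/lit-balaban-p12/renders-cmp110ms/ms87-cmp110-pdfp002,023-journalp262,283-x3.png`).
Lean lane of the lit-balaban YM LIT SWEEP CONTEXT row X1 (register level; zero weight for any token of that table); the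
model is the `d = 4` HIERARCHICAL `SU(2)` gauge model, NOT lattice Yang–Mills.

**What the paper prints (p.283).** L.19–21: *«The limit Gibbs factor g^{(−n)}(u) has a zero set of Haar measure zero
since this set consists at most of a finite number of conjugacy classes (h^{(−n)} can only have discrete zeros).»*
L.38–39: *«The property 𝒯g^{(−n−1)}(u) = g^{(−n)}(u) implies g^{(−n)}(u) > 0 on G, since g^{(−n−1)}(u) is
nonnegative and vanishes at most on a set of Haar measure zero.»* Here `𝒯` is Migdal's recursion (1.1)
`𝒯g(u) = {g^{*r}(u)/g^{*r}(e₀)}^r`, `r = 2` or `4`, with the convolutions taken for the normalised Haar measure.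

**What this file proves (kernel-checked, 0 sorry, standard axioms; no definition, no named fact).** On an arbitrary
compact group `G` (the tree's `haarProbability G`, `haarConv`, and the sibling `MS87MigdalRecursion`'s `convPow`,
`migdal`):
* §1 the substitution `v ↦ v⁻¹u` preserves the Haar probability measure (`measurePreserving_inv_mul_right`), so
  almost-everywhere positivity is transported along it (`ae_pos_comp_inv_mul`); for `g ≥ 0`, «vanishes at most on a
  set of Haar measure zero» is the same as «`g > 0` almost everywhere» (`ae_pos_of_null_zeroSet`).
* §2 **`(k ⋆ f)(u) > 0` for EVERY `u`** as soon as `k, f` are continuous, `≥ 0` and `> 0` almost everywhere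
  (`haarConv_pos_of_ae_pos`: the continuous integrand `k(v)f(v⁻¹u) ≥ 0` is `> 0` on a set of full, hence positive,
  measure); hence every proper convolution power `g^{*(n+2)}` of such a `g` is everywhere `> 0`
  (`convPow_succ_pos_of_ae_pos`) and **`𝒯g > 0` on `G` for `r ≥ 2`** (`migdal_pos_of_ae_pos`).
* §3 the sentence of L.38–39 as printed: if `𝒯g′ = g` with `g′` continuous, `≥ 0`, vanishing at most on a Haar-null
  set, then `g > 0` on `G` (`pos_of_migdal_eq`).

**Readings / scope (declared).** (i) The statement is proved for Migdal's recursion on any compact group and any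
`r ≥ 2` (the paper: `G = SU(2)`, `r ∈ {2, 4}`). (ii) The zero-set statement of L.19–21 itself (finitely many conjugacy
classes are Haar-null on `SU(2)`) is NOT formalized here; it enters §3 as the hypothesis «Haar-null zero set».

**Not claimed.** Theorem 3; the zero-set lemma L.19–21; anything about lattice Yang–Mills or the Clay problem.
-/

open MeasureTheory Filter Set
open scoped Topology ENNReal

namespace Literature.MathematicalPhysics.QuantumFieldTheory

namespace MullerSchiemann1987

namespace MigdalPositivity

open Literature.MathematicalPhysics.QuantumFieldTheory (haarProbability)
open Literature.MathematicalPhysics.QuantumLattice (haarConv haarConv_apply)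
open Migdal (convPow migdal convPow_succ convPow_zero migdal_apply continuous_convPow convPow_nonneg)

variable {G : Type*} [Group G] [TopologicalSpace G] [IsTopologicalGroup G] [CompactSpace G]
  [MeasurableSpace G] [BorelSpace G]

/-! ## §1 Haar-null zero sets and the substitution `v ↦ v⁻¹u` -/

/-- The substitution `v ↦ v⁻¹u` of the convolution integrand preserves the Haar probability measure (inversion
invariance and right invariance of the Haar measure of a compact group). [cite: MullerSchiemann1987, (1.1) p.262,
p.283 L.38–39] -/
theorem measurePreserving_inv_mul_right (u : G) :
    MeasurePreserving (fun v : G => v⁻¹ * u) (haarProbability G) (haarProbability G) :=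
  (measurePreserving_mul_right (haarProbability G) u).comp (Measure.measurePreserving_inv (haarProbability G))

/-- Almost-everywhere positivity is transported along `v ↦ v⁻¹u`. [cite: MullerSchiemann1987, p.283 L.38–39] -/
theorem ae_pos_comp_inv_mul {f : G → ℝ} (hf : ∀ᵐ v ∂(haarProbability G), 0 < f v) (u : G) :
    ∀ᵐ v ∂(haarProbability G), 0 < f (v⁻¹ * u) :=
  (measurePreserving_inv_mul_right u).quasiMeasurePreserving.ae (p := fun x => 0 < f x) hf

/-- For `g ≥ 0`: «vanishes at most on a set of Haar measure zero» ⟺ `g > 0` almost everywhere.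
[cite: MullerSchiemann1987, p.283 L.19–21, L.38–39] -/
theorem ae_pos_of_null_zeroSet {g : G → ℝ} (hg0 : ∀ v, 0 ≤ g v)
    (hz : haarProbability G {v | g v = 0} = 0) : ∀ᵐ v ∂(haarProbability G), 0 < g v := by
  rw [ae_iff]
  have e : {v : G | ¬0 < g v} = {v | g v = 0} := by
    ext v
    simp only [mem_setOf_eq, not_lt]
    exact ⟨fun h => le_antisymm h (hg0 v), fun h => h.le⟩
  rw [e, hz]

/-! ## §2 Convolutions of a.e.-positive nonnegative continuous functions are everywhere positive -/

/-- A set of full Haar probability measure has positive measure. [cite: MullerSchiemann1987, p.283 L.38–39] -/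
theorem measure_pos_of_ae {p : G → Prop} (hp : ∀ᵐ v ∂(haarProbability G), p v) :
    0 < haarProbability G {v | p v} := by
  rw [pos_iff_ne_zero]
  intro h0
  have h1 : haarProbability G {v | ¬p v} = 0 := ae_iff.mp hp
  have hu : (univ : Set G) = {v | p v} ∪ {v | ¬p v} := by
    ext v
    simp only [mem_univ, mem_union, mem_setOf_eq, true_iff]
    exact em _
  have hle : haarProbability G univ ≤ 0 := by
    rw [hu]
    exact (measure_union_le _ _).trans (by rw [h0, h1, add_zero])
  rw [measure_univ] at hle
  exact absurd hle (not_le.mpr zero_lt_one)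

/-- **`(k ⋆ f)(u) > 0` for every `u`**: `k, f` continuous, `≥ 0`, and `> 0` almost everywhere ⟹ the convolution
`(k ⋆ f)(u) = ∫ k(v) f(v⁻¹u) dv` is positive at EVERY point (the integrand is continuous, `≥ 0`, and `> 0` on the
intersection of two sets of full measure). [cite: MullerSchiemann1987, (1.1) p.262, p.283 L.38–39] -/
theorem haarConv_pos_of_ae_pos {k f : G → ℝ} (hk : Continuous k) (hf : Continuous f) (hk0 : ∀ v, 0 ≤ k v)
    (hf0 : ∀ v, 0 ≤ f v) (hk1 : ∀ᵐ v ∂(haarProbability G), 0 < k v)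
    (hf1 : ∀ᵐ v ∂(haarProbability G), 0 < f v) (u : G) : 0 < haarConv k f u := by
  rw [haarConv_apply]
  have hF : Continuous fun v => k v * f (v⁻¹ * u) := hk.mul (hf.comp (continuous_inv.mul continuous_const))
  have hFi : Integrable (fun v => k v * f (v⁻¹ * u)) (haarProbability G) :=
    hF.integrable_of_hasCompactSupport (HasCompactSupport.of_compactSpace _)
  have hF0 : 0 ≤ᵐ[haarProbability G] fun v => k v * f (v⁻¹ * u) :=
    Eventually.of_forall fun v => mul_nonneg (hk0 v) (hf0 _)
  rw [integral_pos_iff_support_of_nonneg_ae hF0 hFi]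
  have hpos : ∀ᵐ v ∂(haarProbability G), 0 < k v * f (v⁻¹ * u) := by
    filter_upwards [hk1, ae_pos_comp_inv_mul hf1 u] with v h1 h2 using mul_pos h1 h2
  have hsub : {v | 0 < k v * f (v⁻¹ * u)} ⊆ Function.support fun v => k v * f (v⁻¹ * u) :=
    fun v hv => ne_of_gt hv
  exact lt_of_lt_of_le (measure_pos_of_ae hpos) (measure_mono hsub)

/-- Proper convolution powers of a continuous `g ≥ 0` that is `> 0` almost everywhere are EVERYWHERE positive:
`g^{*(n+2)}(u) > 0` (`convPow g (n + 1) = g^{*(n+2)}`). [cite: MullerSchiemann1987, (1.1) p.262, p.283 L.38–39] -/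
theorem convPow_succ_pos_of_ae_pos {g : G → ℝ} (hg : Continuous g) (hg0 : ∀ v, 0 ≤ g v)
    (hg1 : ∀ᵐ v ∂(haarProbability G), 0 < g v) : ∀ (n : ℕ) (u : G), 0 < convPow g (n + 1) u
  | 0, u => by
    rw [convPow_succ, convPow_zero]
    exact haarConv_pos_of_ae_pos hg hg hg0 hg0 hg1 hg1 u
  | n + 1, u => by
    rw [convPow_succ]
    exact haarConv_pos_of_ae_pos hg (continuous_convPow hg _) hg0 (convPow_nonneg hg0 _) hg1
      (Eventually.of_forall fun v => convPow_succ_pos_of_ae_pos hg hg0 hg1 n v) u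

/-- **`𝒯g > 0` on `G`** (`r ≥ 2`) for `g` continuous, `≥ 0` and `> 0` almost everywhere.
[cite: MullerSchiemann1987, (1.1) p.262, p.283 L.38–39] -/
theorem migdal_pos_of_ae_pos {g : G → ℝ} (hg : Continuous g) (hg0 : ∀ v, 0 ≤ g v)
    (hg1 : ∀ᵐ v ∂(haarProbability G), 0 < g v) {r : ℕ} (hr : 2 ≤ r) (u : G) : 0 < migdal r g u := by
  rw [migdal_apply]
  obtain ⟨m, hm⟩ : ∃ m, r - 1 = m + 1 := ⟨r - 2, by omega⟩
  rw [hm]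
  exact pow_pos (div_pos (convPow_succ_pos_of_ae_pos hg hg0 hg1 m u)
    (convPow_succ_pos_of_ae_pos hg hg0 hg1 m 1)) r

/-! ## §3 The sentence of p.283 L.38–39 -/

/-- **«The property 𝒯g^{(−n−1)}(u) = g^{(−n)}(u) implies g^{(−n)}(u) > 0 on G, since g^{(−n−1)}(u) is nonnegative
and vanishes at most on a set of Haar measure zero»** (`r ≥ 2`; `g′` continuous).
[cite: MullerSchiemann1987, Thm 3 proof p.283 L.38–39] -/
theorem pos_of_migdal_eq {g g' : G → ℝ} {r : ℕ} (hr : 2 ≤ r) (hT : migdal r g' = g) (hc : Continuous g')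
    (h0 : ∀ v, 0 ≤ g' v) (hz : haarProbability G {v | g' v = 0} = 0) (u : G) : 0 < g u := by
  rw [← hT]
  exact migdal_pos_of_ae_pos hc h0 (ae_pos_of_null_zeroSet h0 hz) hr u

end MigdalPositivity

end MullerSchiemann1987

end Literature.MathematicalPhysics.QuantumFieldTheory
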